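import Summits.Ventures.PercRepro.RankLevelSetRuleQWallisSharp

/-!
# PercRepro — A THIRD WALLIS BOUND FROM A LARGER BASE (night-1, gen 17; dossier §28.8)

The upper bound of RankLevelSetRuleQWallisSharp, `x² ≤ 3.15j + 0.74` (`x² = 16^j/C(2j,j)²`), loses `0.0084·j` against
the true `πj + π/4 + O(1/j)`; the same one-step induction from the base `j = 12` (`C(24,12) = 2704156`) gives
* **`centralBinom_sq_mul_ge''`** — `1000·16^j ≤ C(2j,j)²·(3143j + 777)` for `j ≥ 12`, i.e. `x² ≤ 3.143j + 0.777`
(the step condition is `a ≥ 4b`: `3143 ≥ 3108`). Needed where the borderline slices of the families `k ≥ 12` have a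
negative `x`-coefficient for many `m` (dossier §28.8(b)); a general tool. Axioms: standard.
-/

namespace PercRepro

/-- `C(24, 12) = 2704156`. -/
lemma centralBinom_twelve : (12 : ℕ).centralBinom = 2704156 := by
  rw [Nat.centralBinom_eq_two_mul_choose]
  norm_num [Nat.choose_eq_factorial_div_factorial, Nat.factorial]

/-- **Wallis, a sharper upper bound**: `1000·16^j ≤ C(2j,j)²·(3143j + 777)` for `j ≥ 12` (the step is
`4(j+1)²(3143j+777) ≤ (2j+1)²(3143j+3920)`, i.e. `0 ≤ 35j + 811`; the base `j = 12` is
`281474976710656000 ≤ 7312459672336·38493`). -/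
lemma centralBinom_sq_mul_ge'' : ∀ j : ℕ, 12 ≤ j → 1000 * 16 ^ j ≤ j.centralBinom ^ 2 * (3143 * j + 777) := by
  intro j
  induction j with
  | zero => intro h; omega
  | succ j ih =>
    intro hj
    rcases Nat.lt_or_ge j 12 with hlt | hge
    · have h11 : j = 11 := by omega
      subst h11
      rw [show (11 : ℕ) + 1 = 12 by rfl, centralBinom_twelve]
      norm_num
    · have ih' := ih hge
      have hrec := Nat.succ_mul_centralBinom_succ j
      have h1 : (j + 1) ^ 2 * ((j + 1).centralBinom ^ 2 * (3143 * (j + 1) + 777))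
          = 4 * (2 * j + 1) ^ 2 * (3143 * (j + 1) + 777) * j.centralBinom ^ 2 := by
        have : ((j + 1) * (j + 1).centralBinom) ^ 2 = (2 * (2 * j + 1) * j.centralBinom) ^ 2 := by rw [hrec]
        nlinarith [this]
      have h2 : (j + 1) ^ 2 * (1000 * 16 ^ (j + 1)) ≤ (j + 1) ^ 2 * ((j + 1).centralBinom ^ 2 * (3143 * (j + 1) + 777)) := by
        rw [h1]
        calc (j + 1) ^ 2 * (1000 * 16 ^ (j + 1)) = 16 * (j + 1) ^ 2 * (1000 * 16 ^ j) := by ring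
          _ ≤ 16 * (j + 1) ^ 2 * (j.centralBinom ^ 2 * (3143 * j + 777)) := Nat.mul_le_mul_left _ ih'
          _ = (4 * (j + 1) ^ 2 * (3143 * j + 777)) * (4 * j.centralBinom ^ 2) := by ring
          _ ≤ ((2 * j + 1) ^ 2 * (3143 * (j + 1) + 777)) * (4 * j.centralBinom ^ 2) := by
              apply Nat.mul_le_mul_right
              nlinarith
          _ = 4 * (2 * j + 1) ^ 2 * (3143 * (j + 1) + 777) * j.centralBinom ^ 2 := by ring
      exact Nat.le_of_mul_le_mul_left h2 (by positivity)

end PercRepro
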